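import Summits.ABC.ABC.Theorems.IsogenyGlueCongruenceMazurKenkuBoundOfThreeFacts
import Summits.ABC.ABC.Theorems.IsogenyGlueCongruenceMazurKenkuBoundEdixhoven
import Summits.ABC.ABC.Theorems.IsogenyGlueCongruenceMazurKenkuBoundSemistable
import HarnessLib

/-!
# Route `IsogenyGlueCongruence`, crux `MazurKenkuBound` (stmt-ABC-15125), line `Sketch` — the crux
# from the Mazur–Kenku radius ALONE

Lead c19 (2026-08-17). With the Edixhoven input discharged (`edixhovenIntegrality_proof`, file
`IsogenyGlueCongruenceMazurKenkuBoundEdixhoven`, closing stmt-ABC-15990), the landed join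
`mazurKenkuBound_of_radiusItem_of_edixhovenItem` makes the crux `MazurKenkuBound` a consequence of the
single sibling crux item `MazurKenkuRadius` (stmt-ABC-15193, route `RibetTakahashiSplit`: two
`ℚ`-isogenous elliptic curves over `ℚ` are joined by a `ℚ`-isogeny of degree `≤ 163` — Mazur 1978
Thm. 1 + Kenku 1982), for EVERY globally minimal `W'` — no semistability restriction any more
(compare `mazurKenkuBound_isSemistable_of_radius`, lead c17). This is the exact residual content of
the crux: the line's skeleton `Cruxes/MazurKenkuBound/Lines/Sketch.lean` is this theorem with
`hRad` its only stub.

## References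

* H. Pasten, *Shimura curves and the abc conjecture*, J. Number Theory 254 (2024), §3 p. 13.
  [PastenShimura2024]
* B. Mazur, *Rational isogenies of prime degree*, Invent. Math. 44 (1978), Thm. 1. [Mazur1978]
* M. A. Kenku, *On the number of `ℚ`-isomorphism classes of elliptic curves in each `ℚ`-isogeny
  class*, J. Number Theory 15 (1982), Thm. 1. [Kenku1982]
* B. Edixhoven, *On the Manin constants of modular elliptic curves*, Progr. Math. 89 (1991), Prop. 2.
  [EdixhovenManin1991]
-/

-- `Summit.<Summit>.<Problem>` is the mandated summit-side namespace (CONVENTIONS §2); for the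
-- single-conjunct summit `ABC` the two coincide, so the duplicate `ABC.ABC` is deliberate.
set_option linter.dupNamespace false

noncomputable section

namespace Summit.ABC.ABC.Theorems

/-- **The crux `MazurKenkuBound` (stmt-ABC-15125) from the Mazur–Kenku radius (stmt-ABC-15193)
alone**, for every globally minimal `W'`: the join `mazurKenkuBound_of_radiusItem_of_edixhovenItem`
with its Edixhoven input discharged by `edixhovenIntegrality_proof`.
[cite: PastenShimura2024, §3 p. 13] [cite: Mazur1978, Thm. 1] [cite: Kenku1982, Thm. 1]
[cite: EdixhovenManin1991, Prop. 2] -/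
theorem mazurKenkuBound_of_radiusItem
    (hRad : Summit.ABC.ABC.Theses.RibetTakahashiSplit.MazurKenkuRadius) :
    Summit.ABC.ABC.Theses.IsogenyGlueCongruence.MazurKenkuBound :=
  mazurKenkuBound_of_radiusItem_of_edixhovenItem hRad edixhovenIntegrality_proof

/-- The same in the vocabulary of the Literature fact: the crux from Kenku's list form
`mazurKenku_exists_cyclic_isogeny` alone (through `exists_isogeny_degree_le_163`).
[cite: Mazur1978, Thm. 1] [cite: Kenku1982, Thm. 1] -/
theorem mazurKenkuBound_of_mazurKenku'
    (hMK : Literature.NumberTheory.EllipticCurves.mazurKenku_exists_cyclic_isogeny) :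
    Summit.ABC.ABC.Theses.IsogenyGlueCongruence.MazurKenkuBound :=
  mazurKenkuBound_of_radiusItem fun W W' _ _ hW ↦
    Literature.NumberTheory.EllipticCurves.exists_isogeny_degree_le_163 hMK W W' hW

end Summit.ABC.ABC.Theorems

end
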